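import Summits.ValiantsHypothesis.ValiantsHypothesis.Theorems.LacunarySymmetroidMatrixDescartesPivotRankOneFourKillEight

/-!
# `MatrixDescartes` census — rank-one `(2,4)₁`, ONE below / THREE above, chamber (C): kill-eight + circuit trinomial
# (weight-dependent conditions (C_J), (C₁), (C₂), (C₃) of the one/three split; companions of the chamber-(B) files)

HONEST FRAMING.  Object-search cell `pub-symmetroid`, seat `val-sym-mdr-p1` (generation 14); helper file `--supports` the crux item
stmt-ValiantsHypothesis-18050 (`Theses.LacunarySymmetroid.MatrixDescartes`, OPEN, on HOLD) with NO closure claim.  In chamber (C) of the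
split `d₀ < e < d₁ < d₂ < d₃` — degree order `e+d₀ < d₀+d₁ < 2e < d₀+d₂ < e+d₁ < d₀+d₃ < e+d₂ < d₁+d₂ < e+d₃ < d₁+d₃ < d₂+d₃`,
Descartes-with-parity `9`, tree `≤ 7` outside (C) — four of the five negative degrees (`2e`, `e+d₁`, `e+d₂`, `e+d₃`; not `e+d₀`, which
is the lowest degree) sit between two positive pair degrees.  As in `…PivotRankOneFourKillEight` (method, engine, Finset bridge
`card_posRoots_trinomial_eq_zero_of_circuit`): kill the EIGHT other degrees, the consecutive triple keeps the pattern `(+,−,+)` up to a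
global sign, and below the CIRCUIT NUMBER (`β^{p+q} q^q p^p < (p+q)^{p+q} α^q γ^p`, tree `Census.countP_posRoots_trinomial_eq_zero_of_circuit`)
the surviving trinomial has no positive root, so `Z₊ ≤ 8`.  Real-parameter forms (the matrix forms are one-line wrappers through
`det_rankOne_four_sum`, as in the companions):

* **(C_J)** triple `(d₀+d₁, 2e, d₀+d₂)`: `β = |det J|·Π`, `α = w₀w₁Δ₀₁²·Π`, `γ = w₀w₂Δ₀₂²·Π`, `p = 2e−d₀−d₁`, `q = d₀+d₂−2e`
  (`elevenNomial_chamberC_CJ_le_eight`; hypotheses `d₀+d₁ < 2e < d₀+d₂ < e+d₁`);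
* **(C₁)** triple `(d₀+d₂, e+d₁, d₀+d₃)`: `β = w₁|m₁|·Π`, `p = e+d₁−d₀−d₂`, `q = d₀+d₃−e−d₁` (`…_C1_…`; `2e < d₀+d₂ < e+d₁ < d₀+d₃ < e+d₂`);
* **(C₂)** triple `(d₀+d₃, e+d₂, d₁+d₂)`: `β = w₂|m₂|·Π`, `p = e+d₂−d₀−d₃`, `q = d₁−e` (`…_C2_…`; `e+d₁ < d₀+d₃ < e+d₂`, `d₁+d₂ < e+d₃`);
* **(C₃)** triple `(d₁+d₂, e+d₃, d₁+d₃)`: `β = w₃|m₃|·Π`, `p = e+d₃−d₁−d₂`, `q = d₁−e` (`…_C3_…`; `d₀+d₃ < e+d₂`, `d₁+d₂ < e+d₃`).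

`det J` and the pairings are otherwise arbitrary; only the positivity of the two surviving pair coefficients is used.  LOCATED (seat
exp/coverC.py, hub floats, ≈ 1.4·10⁵ adversarial samples of chamber (C) × directions × weights): the kernel kill-seven sets (T₀₃), (T₀₁), (T₁₂)
(`…PivotRankOneOneThreeKillSeven`) together with these four circuit triples cover ≈ 98.9 %; the remainder is covered by three further
weight-free sets (`{2e, e+d₁, e+d₃, d₁+d₃}`, `{d₀+d₁, d₀+d₂, e+d₁, e+d₂}`, `{d₀+d₁, d₀+d₃, e+d₁, e+d₃}`) except ONE sample met with no
grid or circuit certificate at all (`Z₊ = 1` there) — so, unlike chamber (B), the located coverage of (C) by the kill method is NOT yet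
closed; nothing is claimed.  Nothing here bears on `MatrixDescartes` in its window, on `DoorA26` / `DoorA34`, registers / credences, or `VP ≠ VNP`.

[folklore] Tree engine (weighted Rolle) and the circuit number [cite: IlimanDewolff2016, Theorem 3.8 (n = 1)] via the tree lemma.  No
definitions, no named facts.
-/

-- `Summit.ValiantsHypothesis.ValiantsHypothesis.…` repeats a component by the D-0017 layout
-- (single-conjunct summit), which the `dupNamespace` linter flags; the name is mandated.
set_option linter.dupNamespace false

namespace Summit.ValiantsHypothesis.ValiantsHypothesis.Theorems.LacunarySymmetroidMatrixDescartes.Pivot.TwoDirections.BlockLaw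

open Polynomial Matrix Finset
open scoped BigOperators

/-! ## 1. (C_J) -/

/-- **(C_J), chamber (C), real-parameter form.**  The eleven-nomial of the split `d₀ < e < d₁ < d₂ < d₃` (exponent hypotheses `d₀+d₁ < 2e < d₀+d₂ < e+d₁`;
coefficient data arbitrary except the positivity of the two surviving pair coefficients) has at most EIGHT positive roots when the killed
negative term of the pivot term `|det J|·Π` is below the circuit number of its two killed neighbours. -/
theorem elevenNomial_chamberC_CJ_le_eight (e d₀ d₁ d₂ d₃ : ℕ) (h0e : d₀ < e) (he1 : e < d₁) (h12 : d₁ < d₂) (h23 : d₂ < d₃)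
    (hC1 : d₀ + d₁ < 2 * e) (hC2 : 2 * e < d₀ + d₂) (hC3 : d₀ + d₂ < e + d₁)
    (dJ m₀ m₁ m₂ m₃ w₀ w₁ w₂ w₃ D01 D02 D03 D12 D13 D23 : ℝ) (hw₀ : 0 < w₀) (hw₁ : 0 < w₁) (hw₂ : 0 < w₂) (hD01 : 0 < D01) (hD02 : 0 < D02)
    (hcirc : ((-dJ)
        * (((e : ℝ) - d₀) * ((d₁ : ℝ) - e) * ((d₂ : ℝ) - e) * ((d₃ : ℝ) - e) * ((d₀ : ℝ) + d₃ - 2 * e) * ((d₁ : ℝ) + d₂ - 2 * e) * ((d₁ : ℝ) + d₃ - 2 * e) * ((d₂ : ℝ) + d₃ - 2 * e))) ^ (2 * e - d₀ - d₁ + ((d₀ + d₂) - 2 * e)) * (((((d₀ + d₂) - 2 * e : ℕ) : ℝ)) ^ ((d₀ + d₂) - 2 * e) * (((2 * e - d₀ - d₁ : ℕ) : ℝ)) ^ (2 * e - d₀ - d₁))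
      < (((2 * e - d₀ - d₁ + ((d₀ + d₂) - 2 * e) : ℕ) : ℝ)) ^ (2 * e - d₀ - d₁ + ((d₀ + d₂) - 2 * e))
        * ((w₀ * w₁ * D01
          * (((d₁ : ℝ) - e) * ((e : ℝ) - d₀) * ((e : ℝ) + d₂ - d₀ - d₁) * ((e : ℝ) + d₃ - d₀ - d₁) * ((d₃ : ℝ) - d₁) * ((d₂ : ℝ) - d₀) * ((d₃ : ℝ) - d₀) * ((d₂ : ℝ) + d₃ - d₀ - d₁))) ^ ((d₀ + d₂) - 2 * e)
          * (w₀ * w₂ * D02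
          * (((d₂ : ℝ) - e) * ((e : ℝ) + d₁ - d₀ - d₂) * ((e : ℝ) - d₀) * ((e : ℝ) + d₃ - d₀ - d₂) * ((d₃ : ℝ) - d₂) * ((d₁ : ℝ) - d₀) * ((d₁ : ℝ) + d₃ - d₀ - d₂) * ((d₃ : ℝ) - d₀))) ^ (2 * e - d₀ - d₁))) :
    ((∑ i : Fin 11, Polynomial.C ((![dJ, w₀ * m₀, w₁ * m₁, w₂ * m₂, w₃ * m₃, w₀ * w₁ * D01, w₀ * w₂ * D02, w₀ * w₃ * D03, w₁ * w₂ * D12, w₁ * w₃ * D13, w₂ * w₃ * D23] : Fin 11 → ℝ) i) * X ^ ((![2 * e, e + d₀, e + d₁, e + d₂, e + d₃, d₀ + d₁, d₀ + d₂, d₀ + d₃, d₁ + d₂, d₁ + d₃, d₂ + d₃] : Fin 11 → ℕ) i)).roots.toFinset.filter (fun t => 0 < t)).card ≤ 8 := by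
  classical
  have h0e' : (d₀ : ℝ) < e := by exact_mod_cast h0e
  have he1' : (e : ℝ) < d₁ := by exact_mod_cast he1
  have h12' : (d₁ : ℝ) < d₂ := by exact_mod_cast h12
  have h23' : (d₂ : ℝ) < d₃ := by exact_mod_cast h23
  have hC1' : (d₀ : ℝ) + d₁ < 2 * e := by exact_mod_cast hC1
  have hC2' : 2 * (e : ℝ) < d₀ + d₂ := by exact_mod_cast hC2
  have hC3' : (d₀ : ℝ) + d₂ < e + d₁ := by exact_mod_cast hC3
  -- the three distance products
  obtain ⟨PA, hPA⟩ : ∃ x : ℝ, x = ((d₁ : ℝ) - e) * ((e : ℝ) - d₀) * ((e : ℝ) + d₂ - d₀ - d₁) * ((e : ℝ) + d₃ - d₀ - d₁) * ((d₃ : ℝ) - d₁) * ((d₂ : ℝ) - d₀) * ((d₃ : ℝ) - d₀) * ((d₂ : ℝ) + d₃ - d₀ - d₁) := ⟨_, rfl⟩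
  obtain ⟨PB, hPB⟩ : ∃ x : ℝ, x = ((e : ℝ) - d₀) * ((d₁ : ℝ) - e) * ((d₂ : ℝ) - e) * ((d₃ : ℝ) - e) * ((d₀ : ℝ) + d₃ - 2 * e) * ((d₁ : ℝ) + d₂ - 2 * e) * ((d₁ : ℝ) + d₃ - 2 * e) * ((d₂ : ℝ) + d₃ - 2 * e) := ⟨_, rfl⟩
  obtain ⟨PC, hPC⟩ : ∃ x : ℝ, x = ((d₂ : ℝ) - e) * ((e : ℝ) + d₁ - d₀ - d₂) * ((e : ℝ) - d₀) * ((e : ℝ) + d₃ - d₀ - d₂) * ((d₃ : ℝ) - d₂) * ((d₁ : ℝ) - d₀) * ((d₁ : ℝ) + d₃ - d₀ - d₂) * ((d₃ : ℝ) - d₀) := ⟨_, rfl⟩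
  have hPAp : 0 < PA := by
    rw [hPA]
    have f1 : 0 < ((d₁ : ℝ) - e) := by linarith
    have f2 : 0 < ((e : ℝ) - d₀) := by linarith
    have f3 : 0 < ((e : ℝ) + d₂ - d₀ - d₁) := by linarith
    have f4 : 0 < ((e : ℝ) + d₃ - d₀ - d₁) := by linarith
    have f5 : 0 < ((d₃ : ℝ) - d₁) := by linarith
    have f6 : 0 < ((d₂ : ℝ) - d₀) := by linarith
    have f7 : 0 < ((d₃ : ℝ) - d₀) := by linarith
    have f8 : 0 < ((d₂ : ℝ) + d₃ - d₀ - d₁) := by linarith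
    exact mul_pos (mul_pos (mul_pos (mul_pos (mul_pos (mul_pos (mul_pos f1 f2) f3) f4) f5) f6) f7) f8
  have hPCp : 0 < PC := by
    rw [hPC]
    have f1 : 0 < ((d₂ : ℝ) - e) := by linarith
    have f2 : 0 < ((e : ℝ) + d₁ - d₀ - d₂) := by linarith
    have f3 : 0 < ((e : ℝ) - d₀) := by linarith
    have f4 : 0 < ((e : ℝ) + d₃ - d₀ - d₂) := by linarith
    have f5 : 0 < ((d₃ : ℝ) - d₂) := by linarith
    have f6 : 0 < ((d₁ : ℝ) - d₀) := by linarith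
    have f7 : 0 < ((d₁ : ℝ) + d₃ - d₀ - d₂) := by linarith
    have f8 : 0 < ((d₃ : ℝ) - d₀) := by linarith
    exact mul_pos (mul_pos (mul_pos (mul_pos (mul_pos (mul_pos (mul_pos f1 f2) f3) f4) f5) f6) f7) f8
  -- the three surviving coefficients
  obtain ⟨A, hA⟩ : ∃ x : ℝ, x = w₀ * w₁ * D01 * PA := ⟨_, rfl⟩
  obtain ⟨B, hB⟩ : ∃ x : ℝ, x = (-dJ) * PB := ⟨_, rfl⟩
  obtain ⟨C, hC⟩ : ∃ x : ℝ, x = w₀ * w₂ * D02 * PC := ⟨_, rfl⟩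
  have hAp : 0 < A := by rw [hA]; exact mul_pos (mul_pos (mul_pos hw₀ hw₁) hD01) hPAp
  have hCp : 0 < C := by rw [hC]; exact mul_pos (mul_pos (mul_pos hw₀ hw₂) hD02) hPCp
  have hcirc' : B ^ (2 * e - d₀ - d₁ + ((d₀ + d₂) - 2 * e)) * (((((d₀ + d₂) - 2 * e : ℕ) : ℝ)) ^ ((d₀ + d₂) - 2 * e) * (((2 * e - d₀ - d₁ : ℕ) : ℝ)) ^ (2 * e - d₀ - d₁)) < (((2 * e - d₀ - d₁ + ((d₀ + d₂) - 2 * e) : ℕ) : ℝ)) ^ (2 * e - d₀ - d₁ + ((d₀ + d₂) - 2 * e)) * (A ^ ((d₀ + d₂) - 2 * e) * C ^ (2 * e - d₀ - d₁)) := by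
    rw [hA, hB, hC, hPA, hPB, hPC]; exact hcirc
  clear hcirc
  -- eight kills
  have hkills := card_posRoots_le_kills (Finset.univ : Finset (Fin 11)) (![2 * e, e + d₀, e + d₁, e + d₂, e + d₃, d₀ + d₁, d₀ + d₂, d₀ + d₃, d₁ + d₂, d₁ + d₃, d₂ + d₃] : Fin 11 → ℕ) [e + d₀, e + d₁, e + d₂, e + d₃, d₀ + d₃, d₁ + d₂, d₁ + d₃, d₂ + d₃] (![dJ, w₀ * m₀, w₁ * m₁, w₂ * m₂, w₃ * m₃, w₀ * w₁ * D01, w₀ * w₂ * D02, w₀ * w₃ * D03, w₁ * w₂ * D12, w₁ * w₃ * D13, w₂ * w₃ * D23] : Fin 11 → ℝ)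
  have htri : (∑ i ∈ (Finset.univ : Finset (Fin 11)), Polynomial.C ((![dJ, w₀ * m₀, w₁ * m₁, w₂ * m₂, w₃ * m₃, w₀ * w₁ * D01, w₀ * w₂ * D02, w₀ * w₃ * D03, w₁ * w₂ * D12, w₁ * w₃ * D13, w₂ * w₃ * D23] : Fin 11 → ℝ) i
          * (([e + d₀, e + d₁, e + d₂, e + d₃, d₀ + d₃, d₁ + d₂, d₁ + d₃, d₂ + d₃]).map (fun ρ : ℕ => (((((![2 * e, e + d₀, e + d₁, e + d₂, e + d₃, d₀ + d₁, d₀ + d₂, d₀ + d₃, d₁ + d₂, d₁ + d₃, d₂ + d₃] : Fin 11 → ℕ)) i : ℕ) : ℝ) - (ρ : ℝ)))).prod) * X ^ ((![2 * e, e + d₀, e + d₁, e + d₂, e + d₃, d₀ + d₁, d₀ + d₂, d₀ + d₃, d₁ + d₂, d₁ + d₃, d₂ + d₃] : Fin 11 → ℕ) i))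
      = -(Polynomial.C A * X ^ (d₀ + d₁) - Polynomial.C B * X ^ (d₀ + d₁ + (2 * e - d₀ - d₁)) + Polynomial.C C * X ^ (d₀ + d₁ + (2 * e - d₀ - d₁) + ((d₀ + d₂) - 2 * e))) := by
    have e1 : d₀ + d₁ + (2 * e - d₀ - d₁) = 2 * e := by omega
    have e2 : d₀ + d₁ + (2 * e - d₀ - d₁) + ((d₀ + d₂) - 2 * e) = d₀ + d₂ := by omega
    rw [e2, e1]
    have hcoef : ∀ i : Fin 11, (![dJ, w₀ * m₀, w₁ * m₁, w₂ * m₂, w₃ * m₃, w₀ * w₁ * D01, w₀ * w₂ * D02, w₀ * w₃ * D03, w₁ * w₂ * D12, w₁ * w₃ * D13, w₂ * w₃ * D23] : Fin 11 → ℝ) i * (([e + d₀, e + d₁, e + d₂, e + d₃, d₀ + d₃, d₁ + d₂, d₁ + d₃, d₂ + d₃]).map (fun ρ : ℕ => (((((![2 * e, e + d₀, e + d₁, e + d₂, e + d₃, d₀ + d₁, d₀ + d₂, d₀ + d₃, d₁ + d₂, d₁ + d₃, d₂ + d₃] : Fin 11 → ℕ)) i : ℕ) : ℝ) - (ρ :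 ℝ)))).prod
        = (![B, 0, 0, 0, 0, -A, -C, 0, 0, 0, 0] : Fin 11 → ℝ) i := by
      intro i
      fin_cases i <;>
        simp only [Fin.zero_eta, Fin.mk_one, Fin.isValue, Matrix.cons_val_zero, Matrix.cons_val_one,
          List.map_cons, List.map_nil, List.prod_cons, List.prod_nil, hA, hB, hC, hPA, hPB, hPC] <;>
        push_cast <;> ring
    rw [Finset.sum_congr rfl (fun i _ => by rw [hcoef i])]
    simp only [Fin.sum_univ_succ, Fin.sum_univ_zero, Matrix.cons_val_zero, Matrix.cons_val_succ, map_zero, zero_mul,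
      zero_add, add_zero, Polynomial.C_neg]
    ring
  rw [htri, Polynomial.roots_neg] at hkills
  have hzero := card_posRoots_trinomial_eq_zero_of_circuit A B C (d₀ + d₁) (2 * e - d₀ - d₁) ((d₀ + d₂) - 2 * e) hAp hCp (by omega) (by omega) (Or.inr hcirc')
  simp only [List.length_cons, List.length_nil] at hkills
  omega

/-! ## 2. (C₁) -/

/-- **(C₁), chamber (C), real-parameter form.**  The eleven-nomial of the split `d₀ < e < d₁ < d₂ < d₃` (exponent hypotheses `2e < d₀+d₂ < e+d₁ < d₀+d₃ < e+d₂`;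
coefficient data arbitrary except the positivity of the two surviving pair coefficients) has at most EIGHT positive roots when the killed
negative term of letter `1` is below the circuit number of its two killed neighbours. -/
theorem elevenNomial_chamberC_C1_le_eight (e d₀ d₁ d₂ d₃ : ℕ) (h0e : d₀ < e) (he1 : e < d₁) (h12 : d₁ < d₂) (h23 : d₂ < d₃)
    (hC2 : 2 * e < d₀ + d₂) (hC3 : d₀ + d₂ < e + d₁) (hC4 : e + d₁ < d₀ + d₃) (hC5 : d₀ + d₃ < e + d₂)
    (dJ m₀ m₁ m₂ m₃ w₀ w₁ w₂ w₃ D01 D02 D03 D12 D13 D23 : ℝ) (hw₀ : 0 < w₀) (hw₂ : 0 < w₂) (hw₃ : 0 < w₃) (hD02 : 0 < D02) (hD03 : 0 < D03)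
    (hcirc : (w₁ * (-m₁)
        * (((d₁ : ℝ) - e) * ((d₁ : ℝ) - d₀) * ((d₂ : ℝ) - d₁) * ((d₃ : ℝ) - d₁) * ((e : ℝ) - d₀) * ((d₂ : ℝ) - e) * ((d₃ : ℝ) - e) * ((d₂ : ℝ) + d₃ - e - d₁))) ^ ((e + d₁) - d₀ - d₂ + ((d₀ + d₃) - e - d₁)) * (((((d₀ + d₃) - e - d₁ : ℕ) : ℝ)) ^ ((d₀ + d₃) - e - d₁) * ((((e + d₁) - d₀ - d₂ : ℕ) : ℝ)) ^ ((e + d₁) - d₀ - d₂))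
      < ((((e + d₁) - d₀ - d₂ + ((d₀ + d₃) - e - d₁) : ℕ) : ℝ)) ^ ((e + d₁) - d₀ - d₂ + ((d₀ + d₃) - e - d₁))
        * ((w₀ * w₂ * D02
          * (((d₀ : ℝ) + d₂ - 2 * e) * ((d₂ : ℝ) - e) * ((e : ℝ) - d₀) * ((e : ℝ) + d₃ - d₀ - d₂) * ((d₂ : ℝ) - d₁) * ((d₁ : ℝ) - d₀) * ((d₁ : ℝ) + d₃ - d₀ - d₂) * ((d₃ : ℝ) - d₀))) ^ ((d₀ + d₃) - e - d₁)
          * (w₀ * w₃ * D03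
          * (((d₀ : ℝ) + d₃ - 2 * e) * ((d₃ : ℝ) - e) * ((e : ℝ) + d₂ - d₀ - d₃) * ((e : ℝ) - d₀) * ((d₃ : ℝ) - d₁) * ((d₁ : ℝ) + d₂ - d₀ - d₃) * ((d₁ : ℝ) - d₀) * ((d₂ : ℝ) - d₀))) ^ ((e + d₁) - d₀ - d₂))) :
    ((∑ i : Fin 11, Polynomial.C ((![dJ, w₀ * m₀, w₁ * m₁, w₂ * m₂, w₃ * m₃, w₀ * w₁ * D01, w₀ * w₂ * D02, w₀ * w₃ * D03, w₁ * w₂ * D12, w₁ * w₃ * D13, w₂ * w₃ * D23] : Fin 11 → ℝ) i) * X ^ ((![2 * e, e + d₀, e + d₁, e + d₂, e + d₃, d₀ + d₁, d₀ + d₂, d₀ + d₃, d₁ + d₂, d₁ + d₃, d₂ + d₃] : Fin 11 → ℕ) i)).roots.toFinset.filter (fun t => 0 < t)).card ≤ 8 := by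
  classical
  have h0e' : (d₀ : ℝ) < e := by exact_mod_cast h0e
  have he1' : (e : ℝ) < d₁ := by exact_mod_cast he1
  have h12' : (d₁ : ℝ) < d₂ := by exact_mod_cast h12
  have h23' : (d₂ : ℝ) < d₃ := by exact_mod_cast h23
  have hC2' : 2 * (e : ℝ) < d₀ + d₂ := by exact_mod_cast hC2
  have hC3' : (d₀ : ℝ) + d₂ < e + d₁ := by exact_mod_cast hC3
  have hC4' : (e : ℝ) + d₁ < d₀ + d₃ := by exact_mod_cast hC4
  have hC5' : (d₀ : ℝ) + d₃ < e + d₂ := by exact_mod_cast hC5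
  -- the three distance products
  obtain ⟨PA, hPA⟩ : ∃ x : ℝ, x = ((d₀ : ℝ) + d₂ - 2 * e) * ((d₂ : ℝ) - e) * ((e : ℝ) - d₀) * ((e : ℝ) + d₃ - d₀ - d₂) * ((d₂ : ℝ) - d₁) * ((d₁ : ℝ) - d₀) * ((d₁ : ℝ) + d₃ - d₀ - d₂) * ((d₃ : ℝ) - d₀) := ⟨_, rfl⟩
  obtain ⟨PB, hPB⟩ : ∃ x : ℝ, x = ((d₁ : ℝ) - e) * ((d₁ : ℝ) - d₀) * ((d₂ : ℝ) - d₁) * ((d₃ : ℝ) - d₁) * ((e : ℝ) - d₀) * ((d₂ : ℝ) - e) * ((d₃ : ℝ) - e) * ((d₂ : ℝ) + d₃ - e - d₁) := ⟨_, rfl⟩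
  obtain ⟨PC, hPC⟩ : ∃ x : ℝ, x = ((d₀ : ℝ) + d₃ - 2 * e) * ((d₃ : ℝ) - e) * ((e : ℝ) + d₂ - d₀ - d₃) * ((e : ℝ) - d₀) * ((d₃ : ℝ) - d₁) * ((d₁ : ℝ) + d₂ - d₀ - d₃) * ((d₁ : ℝ) - d₀) * ((d₂ : ℝ) - d₀) := ⟨_, rfl⟩
  have hPAp : 0 < PA := by
    rw [hPA]
    have f1 : 0 < ((d₀ : ℝ) + d₂ - 2 * e) := by linarith
    have f2 : 0 < ((d₂ : ℝ) - e) := by linarith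
    have f3 : 0 < ((e : ℝ) - d₀) := by linarith
    have f4 : 0 < ((e : ℝ) + d₃ - d₀ - d₂) := by linarith
    have f5 : 0 < ((d₂ : ℝ) - d₁) := by linarith
    have f6 : 0 < ((d₁ : ℝ) - d₀) := by linarith
    have f7 : 0 < ((d₁ : ℝ) + d₃ - d₀ - d₂) := by linarith
    have f8 : 0 < ((d₃ : ℝ) - d₀) := by linarith
    exact mul_pos (mul_pos (mul_pos (mul_pos (mul_pos (mul_pos (mul_pos f1 f2) f3) f4) f5) f6) f7) f8
  have hPCp : 0 < PC := by
    rw [hPC]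
    have f1 : 0 < ((d₀ : ℝ) + d₃ - 2 * e) := by linarith
    have f2 : 0 < ((d₃ : ℝ) - e) := by linarith
    have f3 : 0 < ((e : ℝ) + d₂ - d₀ - d₃) := by linarith
    have f4 : 0 < ((e : ℝ) - d₀) := by linarith
    have f5 : 0 < ((d₃ : ℝ) - d₁) := by linarith
    have f6 : 0 < ((d₁ : ℝ) + d₂ - d₀ - d₃) := by linarith
    have f7 : 0 < ((d₁ : ℝ) - d₀) := by linarith
    have f8 : 0 < ((d₂ : ℝ) - d₀) := by linarith
    exact mul_pos (mul_pos (mul_pos (mul_pos (mul_pos (mul_pos (mul_pos f1 f2) f3) f4) f5) f6) f7) f8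
  -- the three surviving coefficients
  obtain ⟨A, hA⟩ : ∃ x : ℝ, x = w₀ * w₂ * D02 * PA := ⟨_, rfl⟩
  obtain ⟨B, hB⟩ : ∃ x : ℝ, x = w₁ * (-m₁) * PB := ⟨_, rfl⟩
  obtain ⟨C, hC⟩ : ∃ x : ℝ, x = w₀ * w₃ * D03 * PC := ⟨_, rfl⟩
  have hAp : 0 < A := by rw [hA]; exact mul_pos (mul_pos (mul_pos hw₀ hw₂) hD02) hPAp
  have hCp : 0 < C := by rw [hC]; exact mul_pos (mul_pos (mul_pos hw₀ hw₃) hD03) hPCp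
  have hcirc' : B ^ ((e + d₁) - d₀ - d₂ + ((d₀ + d₃) - e - d₁)) * (((((d₀ + d₃) - e - d₁ : ℕ) : ℝ)) ^ ((d₀ + d₃) - e - d₁) * ((((e + d₁) - d₀ - d₂ : ℕ) : ℝ)) ^ ((e + d₁) - d₀ - d₂)) < ((((e + d₁) - d₀ - d₂ + ((d₀ + d₃) - e - d₁) : ℕ) : ℝ)) ^ ((e + d₁) - d₀ - d₂ + ((d₀ + d₃) - e - d₁)) * (A ^ ((d₀ + d₃) - e - d₁) * C ^ ((e + d₁) - d₀ - d₂)) := by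
    rw [hA, hB, hC, hPA, hPB, hPC]; exact hcirc
  clear hcirc
  -- eight kills
  have hkills := card_posRoots_le_kills (Finset.univ : Finset (Fin 11)) (![2 * e, e + d₀, e + d₁, e + d₂, e + d₃, d₀ + d₁, d₀ + d₂, d₀ + d₃, d₁ + d₂, d₁ + d₃, d₂ + d₃] : Fin 11 → ℕ) [2 * e, e + d₀, e + d₂, e + d₃, d₀ + d₁, d₁ + d₂, d₁ + d₃, d₂ + d₃] (![dJ, w₀ * m₀, w₁ * m₁, w₂ * m₂, w₃ * m₃, w₀ * w₁ * D01, w₀ * w₂ * D02, w₀ * w₃ * D03, w₁ * w₂ * D12, w₁ * w₃ * D13, w₂ * w₃ * D23] : Fin 11 → ℝ)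
  have htri : (∑ i ∈ (Finset.univ : Finset (Fin 11)), Polynomial.C ((![dJ, w₀ * m₀, w₁ * m₁, w₂ * m₂, w₃ * m₃, w₀ * w₁ * D01, w₀ * w₂ * D02, w₀ * w₃ * D03, w₁ * w₂ * D12, w₁ * w₃ * D13, w₂ * w₃ * D23] : Fin 11 → ℝ) i
          * (([2 * e, e + d₀, e + d₂, e + d₃, d₀ + d₁, d₁ + d₂, d₁ + d₃, d₂ + d₃]).map (fun ρ : ℕ => (((((![2 * e, e + d₀, e + d₁, e + d₂, e + d₃, d₀ + d₁, d₀ + d₂, d₀ + d₃, d₁ + d₂, d₁ + d₃, d₂ + d₃] : Fin 11 → ℕ)) i : ℕ) : ℝ) - (ρ : ℝ)))).prod) * X ^ ((![2 * e, e + d₀, e + d₁, e + d₂, e + d₃, d₀ + d₁, d₀ + d₂, d₀ + d₃, d₁ + d₂, d₁ + d₃, d₂ + d₃] : Fin 11 → ℕ) i))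
      = -(Polynomial.C A * X ^ (d₀ + d₂) - Polynomial.C B * X ^ (d₀ + d₂ + ((e + d₁) - d₀ - d₂)) + Polynomial.C C * X ^ (d₀ + d₂ + ((e + d₁) - d₀ - d₂) + ((d₀ + d₃) - e - d₁))) := by
    have e1 : d₀ + d₂ + ((e + d₁) - d₀ - d₂) = e + d₁ := by omega
    have e2 : d₀ + d₂ + ((e + d₁) - d₀ - d₂) + ((d₀ + d₃) - e - d₁) = d₀ + d₃ := by omega
    rw [e2, e1]
    have hcoef : ∀ i : Fin 11, (![dJ, w₀ * m₀, w₁ * m₁, w₂ * m₂, w₃ * m₃, w₀ * w₁ * D01, w₀ * w₂ * D02, w₀ * w₃ * D03, w₁ * w₂ * D12, w₁ * w₃ * D13, w₂ * w₃ * D23] : Fin 11 → ℝ) i * (([2 * e, e + d₀, e + d₂, e + d₃, d₀ + d₁, d₁ + d₂, d₁ + d₃, d₂ + d₃]).map (fun ρ : ℕ => (((((![2 * e, e + d₀, e + d₁, e + d₂, e + d₃, d₀ + d₁, d₀ + d₂, d₀ + d₃, d₁ + d₂, d₁ + d₃, d₂ + d₃] : Fin 11 → ℕ)) i : ℕ)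 : ℝ) - (ρ : ℝ)))).prod
        = (![0, 0, B, 0, 0, 0, -A, -C, 0, 0, 0] : Fin 11 → ℝ) i := by
      intro i
      fin_cases i <;>
        simp only [Fin.zero_eta, Fin.mk_one, Fin.isValue, Matrix.cons_val_zero, Matrix.cons_val_one,
          List.map_cons, List.map_nil, List.prod_cons, List.prod_nil, hA, hB, hC, hPA, hPB, hPC] <;>
        push_cast <;> ring
    rw [Finset.sum_congr rfl (fun i _ => by rw [hcoef i])]
    simp only [Fin.sum_univ_succ, Fin.sum_univ_zero, Matrix.cons_val_zero, Matrix.cons_val_succ, map_zero, zero_mul,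
      zero_add, add_zero, Polynomial.C_neg]
    ring
  rw [htri, Polynomial.roots_neg] at hkills
  have hzero := card_posRoots_trinomial_eq_zero_of_circuit A B C (d₀ + d₂) ((e + d₁) - d₀ - d₂) ((d₀ + d₃) - e - d₁) hAp hCp (by omega) (by omega) (Or.inr hcirc')
  simp only [List.length_cons, List.length_nil] at hkills
  omega

/-! ## 3. (C₂) -/

/-- **(C₂), chamber (C), real-parameter form.**  The eleven-nomial of the split `d₀ < e < d₁ < d₂ < d₃` (exponent hypotheses `e+d₁ < d₀+d₃ < e+d₂`, `d₁+d₂ < e+d₃`;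
coefficient data arbitrary except the positivity of the two surviving pair coefficients) has at most EIGHT positive roots when the killed
negative term of letter `2` is below the circuit number of its two killed neighbours. -/
theorem elevenNomial_chamberC_C2_le_eight (e d₀ d₁ d₂ d₃ : ℕ) (h0e : d₀ < e) (he1 : e < d₁) (h12 : d₁ < d₂) (h23 : d₂ < d₃)
    (hC4 : e + d₁ < d₀ + d₃) (hC5 : d₀ + d₃ < e + d₂) (hC6 : d₁ + d₂ < e + d₃)
    (dJ m₀ m₁ m₂ m₃ w₀ w₁ w₂ w₃ D01 D02 D03 D12 D13 D23 : ℝ) (hw₀ : 0 < w₀) (hw₁ : 0 < w₁) (hw₂ : 0 < w₂) (hw₃ : 0 < w₃) (hD03 : 0 < D03) (hD12 : 0 < D12)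
    (hcirc : (w₂ * (-m₂)
        * (((d₂ : ℝ) - e) * ((d₂ : ℝ) - d₀) * ((d₂ : ℝ) - d₁) * ((d₃ : ℝ) - d₂) * ((e : ℝ) + d₂ - d₀ - d₁) * ((e : ℝ) - d₀) * ((d₁ : ℝ) + d₃ - e - d₂) * ((d₃ : ℝ) - e))) ^ ((e + d₂) - d₀ - d₃ + (d₁ - e)) * ((((d₁ - e : ℕ) : ℝ)) ^ (d₁ - e) * ((((e + d₂) - d₀ - d₃ : ℕ) : ℝ)) ^ ((e + d₂) - d₀ - d₃))
      < ((((e + d₂) - d₀ - d₃ + (d₁ - e) : ℕ) : ℝ)) ^ ((e + d₂) - d₀ - d₃ + (d₁ - e))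
        * ((w₀ * w₃ * D03
          * (((d₀ : ℝ) + d₃ - 2 * e) * ((d₃ : ℝ) - e) * ((d₀ : ℝ) + d₃ - e - d₁) * ((e : ℝ) - d₀) * ((d₃ : ℝ) - d₁) * ((d₃ : ℝ) - d₂) * ((d₁ : ℝ) - d₀) * ((d₂ : ℝ) - d₀))) ^ (d₁ - e)
          * (w₁ * w₂ * D12
          * (((d₁ : ℝ) + d₂ - 2 * e) * ((d₁ : ℝ) + d₂ - e - d₀) * ((d₂ : ℝ) - e) * ((e : ℝ) + d₃ - d₁ - d₂) * ((d₂ : ℝ) - d₀) * ((d₁ : ℝ) - d₀) * ((d₃ : ℝ) - d₂) * ((d₃ : ℝ) - d₁))) ^ ((e + d₂) - d₀ - d₃))) :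
    ((∑ i : Fin 11, Polynomial.C ((![dJ, w₀ * m₀, w₁ * m₁, w₂ * m₂, w₃ * m₃, w₀ * w₁ * D01, w₀ * w₂ * D02, w₀ * w₃ * D03, w₁ * w₂ * D12, w₁ * w₃ * D13, w₂ * w₃ * D23] : Fin 11 → ℝ) i) * X ^ ((![2 * e, e + d₀, e + d₁, e + d₂, e + d₃, d₀ + d₁, d₀ + d₂, d₀ + d₃, d₁ + d₂, d₁ + d₃, d₂ + d₃] : Fin 11 → ℕ) i)).roots.toFinset.filter (fun t => 0 < t)).card ≤ 8 := by
  classical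
  have h0e' : (d₀ : ℝ) < e := by exact_mod_cast h0e
  have he1' : (e : ℝ) < d₁ := by exact_mod_cast he1
  have h12' : (d₁ : ℝ) < d₂ := by exact_mod_cast h12
  have h23' : (d₂ : ℝ) < d₃ := by exact_mod_cast h23
  have hC4' : (e : ℝ) + d₁ < d₀ + d₃ := by exact_mod_cast hC4
  have hC5' : (d₀ : ℝ) + d₃ < e + d₂ := by exact_mod_cast hC5
  have hC6' : (d₁ : ℝ) + d₂ < e + d₃ := by exact_mod_cast hC6
  -- the three distance products
  obtain ⟨PA, hPA⟩ : ∃ x : ℝ, x = ((d₀ : ℝ) + d₃ - 2 * e) * ((d₃ : ℝ) - e) * ((d₀ : ℝ) + d₃ - e - d₁) * ((e : ℝ) - d₀) * ((d₃ : ℝ) - d₁) * ((d₃ : ℝ) - d₂) * ((d₁ : ℝ) - d₀) * ((d₂ : ℝ) - d₀) := ⟨_, rfl⟩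
  obtain ⟨PB, hPB⟩ : ∃ x : ℝ, x = ((d₂ : ℝ) - e) * ((d₂ : ℝ) - d₀) * ((d₂ : ℝ) - d₁) * ((d₃ : ℝ) - d₂) * ((e : ℝ) + d₂ - d₀ - d₁) * ((e : ℝ) - d₀) * ((d₁ : ℝ) + d₃ - e - d₂) * ((d₃ : ℝ) - e) := ⟨_, rfl⟩
  obtain ⟨PC, hPC⟩ : ∃ x : ℝ, x = ((d₁ : ℝ) + d₂ - 2 * e) * ((d₁ : ℝ) + d₂ - e - d₀) * ((d₂ : ℝ) - e) * ((e : ℝ) + d₃ - d₁ - d₂) * ((d₂ : ℝ) - d₀) * ((d₁ : ℝ) - d₀) * ((d₃ : ℝ) - d₂) * ((d₃ : ℝ) - d₁) := ⟨_, rfl⟩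
  have hPAp : 0 < PA := by
    rw [hPA]
    have f1 : 0 < ((d₀ : ℝ) + d₃ - 2 * e) := by linarith
    have f2 : 0 < ((d₃ : ℝ) - e) := by linarith
    have f3 : 0 < ((d₀ : ℝ) + d₃ - e - d₁) := by linarith
    have f4 : 0 < ((e : ℝ) - d₀) := by linarith
    have f5 : 0 < ((d₃ : ℝ) - d₁) := by linarith
    have f6 : 0 < ((d₃ : ℝ) - d₂) := by linarith
    have f7 : 0 < ((d₁ : ℝ) - d₀) := by linarith
    have f8 : 0 < ((d₂ : ℝ) - d₀) := by linarith
    exact mul_pos (mul_pos (mul_pos (mul_pos (mul_pos (mul_pos (mul_pos f1 f2) f3) f4) f5) f6) f7) f8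
  have hPCp : 0 < PC := by
    rw [hPC]
    have f1 : 0 < ((d₁ : ℝ) + d₂ - 2 * e) := by linarith
    have f2 : 0 < ((d₁ : ℝ) + d₂ - e - d₀) := by linarith
    have f3 : 0 < ((d₂ : ℝ) - e) := by linarith
    have f4 : 0 < ((e : ℝ) + d₃ - d₁ - d₂) := by linarith
    have f5 : 0 < ((d₂ : ℝ) - d₀) := by linarith
    have f6 : 0 < ((d₁ : ℝ) - d₀) := by linarith
    have f7 : 0 < ((d₃ : ℝ) - d₂) := by linarith
    have f8 : 0 < ((d₃ : ℝ) - d₁) := by linarith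
    exact mul_pos (mul_pos (mul_pos (mul_pos (mul_pos (mul_pos (mul_pos f1 f2) f3) f4) f5) f6) f7) f8
  -- the three surviving coefficients
  obtain ⟨A, hA⟩ : ∃ x : ℝ, x = w₀ * w₃ * D03 * PA := ⟨_, rfl⟩
  obtain ⟨B, hB⟩ : ∃ x : ℝ, x = w₂ * (-m₂) * PB := ⟨_, rfl⟩
  obtain ⟨C, hC⟩ : ∃ x : ℝ, x = w₁ * w₂ * D12 * PC := ⟨_, rfl⟩
  have hAp : 0 < A := by rw [hA]; exact mul_pos (mul_pos (mul_pos hw₀ hw₃) hD03) hPAp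
  have hCp : 0 < C := by rw [hC]; exact mul_pos (mul_pos (mul_pos hw₁ hw₂) hD12) hPCp
  have hcirc' : B ^ ((e + d₂) - d₀ - d₃ + (d₁ - e)) * ((((d₁ - e : ℕ) : ℝ)) ^ (d₁ - e) * ((((e + d₂) - d₀ - d₃ : ℕ) : ℝ)) ^ ((e + d₂) - d₀ - d₃)) < ((((e + d₂) - d₀ - d₃ + (d₁ - e) : ℕ) : ℝ)) ^ ((e + d₂) - d₀ - d₃ + (d₁ - e)) * (A ^ (d₁ - e) * C ^ ((e + d₂) - d₀ - d₃)) := by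
    rw [hA, hB, hC, hPA, hPB, hPC]; exact hcirc
  clear hcirc
  -- eight kills
  have hkills := card_posRoots_le_kills (Finset.univ : Finset (Fin 11)) (![2 * e, e + d₀, e + d₁, e + d₂, e + d₃, d₀ + d₁, d₀ + d₂, d₀ + d₃, d₁ + d₂, d₁ + d₃, d₂ + d₃] : Fin 11 → ℕ) [2 * e, e + d₀, e + d₁, e + d₃, d₀ + d₁, d₀ + d₂, d₁ + d₃, d₂ + d₃] (![dJ, w₀ * m₀, w₁ * m₁, w₂ * m₂, w₃ * m₃, w₀ * w₁ * D01, w₀ * w₂ * D02, w₀ * w₃ * D03, w₁ * w₂ * D12, w₁ * w₃ * D13, w₂ * w₃ * D23] : Fin 11 → ℝ)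
  have htri : (∑ i ∈ (Finset.univ : Finset (Fin 11)), Polynomial.C ((![dJ, w₀ * m₀, w₁ * m₁, w₂ * m₂, w₃ * m₃, w₀ * w₁ * D01, w₀ * w₂ * D02, w₀ * w₃ * D03, w₁ * w₂ * D12, w₁ * w₃ * D13, w₂ * w₃ * D23] : Fin 11 → ℝ) i
          * (([2 * e, e + d₀, e + d₁, e + d₃, d₀ + d₁, d₀ + d₂, d₁ + d₃, d₂ + d₃]).map (fun ρ : ℕ => (((((![2 * e, e + d₀, e + d₁, e + d₂, e + d₃, d₀ + d₁, d₀ + d₂, d₀ + d₃, d₁ + d₂, d₁ + d₃, d₂ + d₃] : Fin 11 → ℕ)) i : ℕ) : ℝ) - (ρ : ℝ)))).prod) * X ^ ((![2 * e, e + d₀, e + d₁, e + d₂, e + d₃, d₀ + d₁, d₀ + d₂, d₀ + d₃, d₁ + d₂, d₁ + d₃, d₂ + d₃] : Fin 11 → ℕ) i))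
      = -(Polynomial.C A * X ^ (d₀ + d₃) - Polynomial.C B * X ^ (d₀ + d₃ + ((e + d₂) - d₀ - d₃)) + Polynomial.C C * X ^ (d₀ + d₃ + ((e + d₂) - d₀ - d₃) + (d₁ - e))) := by
    have e1 : d₀ + d₃ + ((e + d₂) - d₀ - d₃) = e + d₂ := by omega
    have e2 : d₀ + d₃ + ((e + d₂) - d₀ - d₃) + (d₁ - e) = d₁ + d₂ := by omega
    rw [e2, e1]
    have hcoef : ∀ i : Fin 11, (![dJ, w₀ * m₀, w₁ * m₁, w₂ * m₂, w₃ * m₃, w₀ * w₁ * D01, w₀ * w₂ * D02, w₀ * w₃ * D03, w₁ * w₂ * D12, w₁ * w₃ * D13, w₂ * w₃ * D23] : Fin 11 → ℝ) i * (([2 * e, e + d₀, e + d₁, e + d₃, d₀ + d₁, d₀ + d₂, d₁ + d₃, d₂ + d₃]).map (fun ρ : ℕ => (((((![2 * e, e + d₀, e + d₁, e + d₂, e + d₃, d₀ + d₁, d₀ + d₂, d₀ + d₃, d₁ + d₂, d₁ + d₃, d₂ + d₃] : Fin 11 → ℕ)) i : ℕ) : ℝ) - (ρ : ℝ)))).p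rod
        = (![0, 0, 0, B, 0, 0, 0, -A, -C, 0, 0] : Fin 11 → ℝ) i := by
      intro i
      fin_cases i <;>
        simp only [Fin.zero_eta, Fin.mk_one, Fin.isValue, Matrix.cons_val_zero, Matrix.cons_val_one,
          List.map_cons, List.map_nil, List.prod_cons, List.prod_nil, hA, hB, hC, hPA, hPB, hPC] <;>
        push_cast <;> ring
    rw [Finset.sum_congr rfl (fun i _ => by rw [hcoef i])]
    simp only [Fin.sum_univ_succ, Fin.sum_univ_zero, Matrix.cons_val_zero, Matrix.cons_val_succ, map_zero, zero_mul,
      zero_add, add_zero, Polynomial.C_neg]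
    ring
  rw [htri, Polynomial.roots_neg] at hkills
  have hzero := card_posRoots_trinomial_eq_zero_of_circuit A B C (d₀ + d₃) ((e + d₂) - d₀ - d₃) (d₁ - e) hAp hCp (by omega) (by omega) (Or.inr hcirc')
  simp only [List.length_cons, List.length_nil] at hkills
  omega

/-! ## 4. (C₃) -/

/-- **(C₃), chamber (C), real-parameter form.**  The eleven-nomial of the split `d₀ < e < d₁ < d₂ < d₃` (exponent hypotheses `d₀+d₃ < e+d₂`, `d₁+d₂ < e+d₃`;
coefficient data arbitrary except the positivity of the two surviving pair coefficients) has at most EIGHT positive roots when the killed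
negative term of letter `3` (the top letter) is below the circuit number of its two killed neighbours. -/
theorem elevenNomial_chamberC_C3_le_eight (e d₀ d₁ d₂ d₃ : ℕ) (h0e : d₀ < e) (he1 : e < d₁) (h12 : d₁ < d₂) (h23 : d₂ < d₃)
    (hC5 : d₀ + d₃ < e + d₂) (hC6 : d₁ + d₂ < e + d₃)
    (dJ m₀ m₁ m₂ m₃ w₀ w₁ w₂ w₃ D01 D02 D03 D12 D13 D23 : ℝ) (hw₁ : 0 < w₁) (hw₂ : 0 < w₂) (hw₃ : 0 < w₃) (hD12 : 0 < D12) (hD13 : 0 < D13)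
    (hcirc : (w₃ * (-m₃)
        * (((d₃ : ℝ) - e) * ((d₃ : ℝ) - d₀) * ((d₃ : ℝ) - d₁) * ((d₃ : ℝ) - d₂) * ((e : ℝ) + d₃ - d₀ - d₁) * ((e : ℝ) + d₃ - d₀ - d₂) * ((e : ℝ) - d₀) * ((d₂ : ℝ) - e))) ^ ((e + d₃) - d₁ - d₂ + (d₁ - e)) * ((((d₁ - e : ℕ) : ℝ)) ^ (d₁ - e) * ((((e + d₃) - d₁ - d₂ : ℕ) : ℝ)) ^ ((e + d₃) - d₁ - d₂))
      < ((((e + d₃) - d₁ - d₂ + (d₁ - e) : ℕ) : ℝ)) ^ ((e + d₃) - d₁ - d₂ + (d₁ - e))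
        * ((w₁ * w₂ * D12
          * (((d₁ : ℝ) + d₂ - 2 * e) * ((d₁ : ℝ) + d₂ - e - d₀) * ((d₂ : ℝ) - e) * ((d₁ : ℝ) - e) * ((d₂ : ℝ) - d₀) * ((d₁ : ℝ) - d₀) * ((d₁ : ℝ) + d₂ - d₀ - d₃) * ((d₃ : ℝ) - d₁))) ^ (d₁ - e)
          * (w₁ * w₃ * D13
          * (((d₁ : ℝ) + d₃ - 2 * e) * ((d₁ : ℝ) + d₃ - e - d₀) * ((d₃ : ℝ) - e) * ((d₁ : ℝ) + d₃ - e - d₂) * ((d₃ : ℝ) - d₀) * ((d₁ : ℝ) + d₃ - d₀ - d₂) * ((d₁ : ℝ) - d₀) * ((d₂ : ℝ) - d₁))) ^ ((e + d₃) - d₁ - d₂))) :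
    ((∑ i : Fin 11, Polynomial.C ((![dJ, w₀ * m₀, w₁ * m₁, w₂ * m₂, w₃ * m₃, w₀ * w₁ * D01, w₀ * w₂ * D02, w₀ * w₃ * D03, w₁ * w₂ * D12, w₁ * w₃ * D13, w₂ * w₃ * D23] : Fin 11 → ℝ) i) * X ^ ((![2 * e, e + d₀, e + d₁, e + d₂, e + d₃, d₀ + d₁, d₀ + d₂, d₀ + d₃, d₁ + d₂, d₁ + d₃, d₂ + d₃] : Fin 11 → ℕ) i)).roots.toFinset.filter (fun t => 0 < t)).card ≤ 8 := by
  classical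
  have h0e' : (d₀ : ℝ) < e := by exact_mod_cast h0e
  have he1' : (e : ℝ) < d₁ := by exact_mod_cast he1
  have h12' : (d₁ : ℝ) < d₂ := by exact_mod_cast h12
  have h23' : (d₂ : ℝ) < d₃ := by exact_mod_cast h23
  have hC5' : (d₀ : ℝ) + d₃ < e + d₂ := by exact_mod_cast hC5
  have hC6' : (d₁ : ℝ) + d₂ < e + d₃ := by exact_mod_cast hC6
  -- the three distance products
  obtain ⟨PA, hPA⟩ : ∃ x : ℝ, x = ((d₁ : ℝ) + d₂ - 2 * e) * ((d₁ : ℝ) + d₂ - e - d₀) * ((d₂ : ℝ) - e) * ((d₁ : ℝ) - e) * ((d₂ : ℝ) - d₀) * ((d₁ : ℝ) - d₀) * ((d₁ : ℝ) + d₂ - d₀ - d₃) * ((d₃ : ℝ) - d₁) := ⟨_, rfl⟩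
  obtain ⟨PB, hPB⟩ : ∃ x : ℝ, x = ((d₃ : ℝ) - e) * ((d₃ : ℝ) - d₀) * ((d₃ : ℝ) - d₁) * ((d₃ : ℝ) - d₂) * ((e : ℝ) + d₃ - d₀ - d₁) * ((e : ℝ) + d₃ - d₀ - d₂) * ((e : ℝ) - d₀) * ((d₂ : ℝ) - e) := ⟨_, rfl⟩
  obtain ⟨PC, hPC⟩ : ∃ x : ℝ, x = ((d₁ : ℝ) + d₃ - 2 * e) * ((d₁ : ℝ) + d₃ - e - d₀) * ((d₃ : ℝ) - e) * ((d₁ : ℝ) + d₃ - e - d₂) * ((d₃ : ℝ) - d₀) * ((d₁ : ℝ) + d₃ - d₀ - d₂) * ((d₁ : ℝ) - d₀) * ((d₂ : ℝ) - d₁) := ⟨_, rfl⟩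
  have hPAp : 0 < PA := by
    rw [hPA]
    have f1 : 0 < ((d₁ : ℝ) + d₂ - 2 * e) := by linarith
    have f2 : 0 < ((d₁ : ℝ) + d₂ - e - d₀) := by linarith
    have f3 : 0 < ((d₂ : ℝ) - e) := by linarith
    have f4 : 0 < ((d₁ : ℝ) - e) := by linarith
    have f5 : 0 < ((d₂ : ℝ) - d₀) := by linarith
    have f6 : 0 < ((d₁ : ℝ) - d₀) := by linarith
    have f7 : 0 < ((d₁ : ℝ) + d₂ - d₀ - d₃) := by linarith
    have f8 : 0 < ((d₃ : ℝ) - d₁) := by linarith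
    exact mul_pos (mul_pos (mul_pos (mul_pos (mul_pos (mul_pos (mul_pos f1 f2) f3) f4) f5) f6) f7) f8
  have hPCp : 0 < PC := by
    rw [hPC]
    have f1 : 0 < ((d₁ : ℝ) + d₃ - 2 * e) := by linarith
    have f2 : 0 < ((d₁ : ℝ) + d₃ - e - d₀) := by linarith
    have f3 : 0 < ((d₃ : ℝ) - e) := by linarith
    have f4 : 0 < ((d₁ : ℝ) + d₃ - e - d₂) := by linarith
    have f5 : 0 < ((d₃ : ℝ) - d₀) := by linarith
    have f6 : 0 < ((d₁ : ℝ) + d₃ - d₀ - d₂) := by linarith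
    have f7 : 0 < ((d₁ : ℝ) - d₀) := by linarith
    have f8 : 0 < ((d₂ : ℝ) - d₁) := by linarith
    exact mul_pos (mul_pos (mul_pos (mul_pos (mul_pos (mul_pos (mul_pos f1 f2) f3) f4) f5) f6) f7) f8
  -- the three surviving coefficients
  obtain ⟨A, hA⟩ : ∃ x : ℝ, x = w₁ * w₂ * D12 * PA := ⟨_, rfl⟩
  obtain ⟨B, hB⟩ : ∃ x : ℝ, x = w₃ * (-m₃) * PB := ⟨_, rfl⟩
  obtain ⟨C, hC⟩ : ∃ x : ℝ, x = w₁ * w₃ * D13 * PC := ⟨_, rfl⟩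
  have hAp : 0 < A := by rw [hA]; exact mul_pos (mul_pos (mul_pos hw₁ hw₂) hD12) hPAp
  have hCp : 0 < C := by rw [hC]; exact mul_pos (mul_pos (mul_pos hw₁ hw₃) hD13) hPCp
  have hcirc' : B ^ ((e + d₃) - d₁ - d₂ + (d₁ - e)) * ((((d₁ - e : ℕ) : ℝ)) ^ (d₁ - e) * ((((e + d₃) - d₁ - d₂ : ℕ) : ℝ)) ^ ((e + d₃) - d₁ - d₂)) < ((((e + d₃) - d₁ - d₂ + (d₁ - e) : ℕ) : ℝ)) ^ ((e + d₃) - d₁ - d₂ + (d₁ - e)) * (A ^ (d₁ - e) * C ^ ((e + d₃) - d₁ - d₂)) := by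
    rw [hA, hB, hC, hPA, hPB, hPC]; exact hcirc
  clear hcirc
  -- eight kills
  have hkills := card_posRoots_le_kills (Finset.univ : Finset (Fin 11)) (![2 * e, e + d₀, e + d₁, e + d₂, e + d₃, d₀ + d₁, d₀ + d₂, d₀ + d₃, d₁ + d₂, d₁ + d₃, d₂ + d₃] : Fin 11 → ℕ) [2 * e, e + d₀, e + d₁, e + d₂, d₀ + d₁, d₀ + d₂, d₀ + d₃, d₂ + d₃] (![dJ, w₀ * m₀, w₁ * m₁, w₂ * m₂, w₃ * m₃, w₀ * w₁ * D01, w₀ * w₂ * D02, w₀ * w₃ * D03, w₁ * w₂ * D12, w₁ * w₃ * D13, w₂ * w₃ * D23] : Fin 11 → ℝ)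
  have htri : (∑ i ∈ (Finset.univ : Finset (Fin 11)), Polynomial.C ((![dJ, w₀ * m₀, w₁ * m₁, w₂ * m₂, w₃ * m₃, w₀ * w₁ * D01, w₀ * w₂ * D02, w₀ * w₃ * D03, w₁ * w₂ * D12, w₁ * w₃ * D13, w₂ * w₃ * D23] : Fin 11 → ℝ) i
          * (([2 * e, e + d₀, e + d₁, e + d₂, d₀ + d₁, d₀ + d₂, d₀ + d₃, d₂ + d₃]).map (fun ρ : ℕ => (((((![2 * e, e + d₀, e + d₁, e + d₂, e + d₃, d₀ + d₁, d₀ + d₂, d₀ + d₃, d₁ + d₂, d₁ + d₃, d₂ + d₃] : Fin 11 → ℕ)) i : ℕ) : ℝ) - (ρ : ℝ)))).prod) * X ^ ((![2 * e, e + d₀, e + d₁, e + d₂, e + d₃, d₀ + d₁, d₀ + d₂, d₀ + d₃, d₁ + d₂, d₁ + d₃, d₂ + d₃] : Fin 11 → ℕ) i))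
      = -(Polynomial.C A * X ^ (d₁ + d₂) - Polynomial.C B * X ^ (d₁ + d₂ + ((e + d₃) - d₁ - d₂)) + Polynomial.C C * X ^ (d₁ + d₂ + ((e + d₃) - d₁ - d₂) + (d₁ - e))) := by
    have e1 : d₁ + d₂ + ((e + d₃) - d₁ - d₂) = e + d₃ := by omega
    have e2 : d₁ + d₂ + ((e + d₃) - d₁ - d₂) + (d₁ - e) = d₁ + d₃ := by omega
    rw [e2, e1]
    have hcoef : ∀ i : Fin 11, (![dJ, w₀ * m₀, w₁ * m₁, w₂ * m₂, w₃ * m₃, w₀ * w₁ * D01, w₀ * w₂ * D02, w₀ * w₃ * D03, w₁ * w₂ * D12, w₁ * w₃ * D13, w₂ * w₃ * D23] : Fin 11 → ℝ) i * (([2 * e, e + d₀, e + d₁, e + d₂, d₀ + d₁, d₀ + d₂, d₀ + d₃, d₂ + d₃]).map (fun ρ : ℕ => (((((![2 * e, e + d₀, e + d₁, e + d₂, e + d₃, d₀ + d₁, d₀ + d₂, d₀ + d₃, d₁ + d₂, d₁ + d₃, d₂ + d₃] : Fin 11 → ℕ)) i : ℕ) : ℝ) - (ρ : ℝ)))).p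rod
        = (![0, 0, 0, 0, B, 0, 0, 0, -A, -C, 0] : Fin 11 → ℝ) i := by
      intro i
      fin_cases i <;>
        simp only [Fin.zero_eta, Fin.mk_one, Fin.isValue, Matrix.cons_val_zero, Matrix.cons_val_one,
          List.map_cons, List.map_nil, List.prod_cons, List.prod_nil, hA, hB, hC, hPA, hPB, hPC] <;>
        push_cast <;> ring
    rw [Finset.sum_congr rfl (fun i _ => by rw [hcoef i])]
    simp only [Fin.sum_univ_succ, Fin.sum_univ_zero, Matrix.cons_val_zero, Matrix.cons_val_succ, map_zero, zero_mul,
      zero_add, add_zero, Polynomial.C_neg]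
    ring
  rw [htri, Polynomial.roots_neg] at hkills
  have hzero := card_posRoots_trinomial_eq_zero_of_circuit A B C (d₁ + d₂) ((e + d₃) - d₁ - d₂) (d₁ - e) hAp hCp (by omega) (by omega) (Or.inr hcirc')
  simp only [List.length_cons, List.length_nil] at hkills
  omega

end Summit.ValiantsHypothesis.ValiantsHypothesis.Theorems.LacunarySymmetroidMatrixDescartes.Pivot.TwoDirections.BlockLaw
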